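import Literature.Topology.FourManifolds.TrisectionFunctorGKGenusZero
import Literature.Topology.FourManifolds.HandlebodySymmetricModels
import Literature.Topology.FourManifolds.CerfGammaFourProofs
import HarnessLib

/-!
# Abrams–Gay–Kirby, Thm. 5 (the map `ℳ`): naturality and universe bookkeeping for fact (e′)

Topic `Literature/Topology/FourManifolds`; sibling of `TrisectionFunctorGK.lean` (fact seat
`provefact-Literature.Topology.FourManifolds.exists-96a109ad20`, named fact (e′)
`Literature.Topology.FourManifolds.exists_gkTrisected_of_isGroupTrisection`, Abrams–Gay–Kirby 2018, Thm. 5).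

## Status of (e′) (read first)

(e′) is the surjectivity half of Abrams–Gay–Kirby's Theorem 5: every `(g, k)` group trisection
is, up to isomorphism, the kernel triple `𝒢` of a balanced Gay–Kirby trisection of some closed,
connected, oriented smooth 4-manifold.  Its printed proof (pp. 1541–1542) realises the three
epimorphisms `S_g ↠ H_g` by handlebody fillings of `Σ_g` (Leininger–Reid; Dehn's lemma),
recognises the three resulting closed 3-manifolds with free `π₁` of rank `k` as `#ᵏ(S¹ × S²)`
(Kneser's conjecture/Stallings, **Perelman's proof of the 3-dimensional Poincaré conjecture**,
the Sphere Theorem) and fills them with `♮ᵏ(S¹ × B³)` (Laudenbach–Poénaru).  None of this is in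
the tree or Mathlib; the only Gay–Kirby trisection formalised so far is the genus-`0` trisection
of the round `S⁴` (`SphereTrisectionsSectors.lean`), giving the genus-`0` clause of Theorem 5 at
universe `0` (`exists_gkTrisected_of_isGroupTrisection_genusZero`).  (e′) stays a named fact;
this file does NOT discharge it, changes no statement and introduces no new named fact.

## What is proved here (the bottom layer of any future discharge, which will build `X : Type`)

* `IsGKTrisection.image_diffeomorph` — **Gay–Kirby's Def. 1 is natural under diffeomorphisms**
  `Φ : X ≅ X'` (sectors `Φ '' S i`; pieces `W`, `H` kept, `ULift`ed to the universe of `X'`;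
  embeddings, immersions, corner charts and smooth embeddings composed with `Φ`);
  `IsGKTrisection.image_diffeomorph'` is the same-universe form.
* `exists_groupGKTrisectionOf_eq_of_homeomorph` — **the kernel triple `𝒢` is natural**: along a
  homeomorphism carrying sectors to sectors, `x₀ ↦ Φ x₀` and `μ ↦ (Φ|_F)_* ∘ μ` give literally
  the same kernel triple (`π₁` functoriality; `Homeomorph.fundamentalGroup_map_bijective`) —
  Abrams–Gay–Kirby, p. 1540: `𝒢` is read "up to trisected diffeomorphism".
* `gkTrisected_ulift` — a kernel triple realised by a trisected closed connected oriented smooth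
  `X : Type` is realised in every universe (`ULift X`, `ManifoldULift`).
* `exists_gkTrisected_of_isGroupTrisection_of_univ_zero` — **(e′).{0} implies (e′).{u}** (apply
  (e′).{0} to the triple quotient `S_g/⟪K₁ ∪ K₂ ∪ K₃⟫ : Type`, trisected by the same kernels, and
  lift): the exact shape of a future `…_holds`.
* `exists_gkTrisected_of_isGroupTrisection_genusZero_univ` — the genus-`0` clause of Theorem 5
  ("the unique `(0, 0)`-trisection of `{1}` maps to the unique `(0, 0)`-trisection of `S⁴`") at
  every universe, i.e. the `g = 0` instance of (e′).{u} for all `u` (previously `u = 0` only).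

## References

* A. Abrams, D. Gay, R. Kirby, *Group trisections and smooth 4-manifolds*, Geom. Topol. 22 (2018)
  1537–1545 (arXiv:1605.06731): the map `𝒢`, p. 1540; Thm. 5, p. 1541; its proof, pp. 1541–1542.
* D. Gay, R. Kirby, *Trisecting 4-manifolds*, Geom. Topol. 20 (2016) 3097–3132: Def. 1.
* A. Hatcher, *Algebraic Topology*, CUP 2002, §1.1, p. 34 (induced homomorphisms of `π₁`).
-/

noncomputable section

open Set Function
open scoped Manifold ContDiff Topology

namespace Literature.Topology.FourManifolds

universe u v

/-! ### `π₁` functoriality (Mathlib's `FundamentalGroup.map`) -/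

section FundamentalGroupMap

variable {A B C : Type*} [TopologicalSpace A] [TopologicalSpace B] [TopologicalSpace C]

/-- Functoriality of `FundamentalGroup.map`: `(g ∘ f)_* = g_* ∘ f_*` on `π₁(A, a)`
(Hatcher, *Algebraic Topology*, §1.1, p. 34). [folklore] -/
theorem fundamentalGroup_map_comp_apply (f : C(A, B)) (g : C(B, C)) (a : A)
    (p : FundamentalGroup A a) :
    FundamentalGroup.map (g.comp f) a p =
      FundamentalGroup.map g (f a) (FundamentalGroup.map f a p) := by
  induction p using Quotient.ind with
  | _ ℓ => rfl

/-- The identity induces the identity of `π₁(A, a)` (Hatcher, §1.1). [folklore] -/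
theorem fundamentalGroup_map_id_apply (a : A) (p : FundamentalGroup A a) :
    FundamentalGroup.map (ContinuousMap.id A) a p = p := by
  induction p using Quotient.ind with
  | _ ℓ => exact congrArg (fun γ : Path a a => (⟦γ⟧ : Path.Homotopic.Quotient a a)) (Path.map_id ℓ)

/-- A continuous self-map equal to the identity induces an injection (indeed the identity) on
`π₁(A, a)`; stated through an equation `f = id` so that the base points `f a` and `a` need not be
compared. [folklore] -/
theorem fundamentalGroup_map_injective_of_eq_id {f : C(A, A)} (hf : f = ContinuousMap.id A)
    (a : A) : Function.Injective (FundamentalGroup.map f a) := by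
  subst hf
  intro p q h
  rwa [fundamentalGroup_map_id_apply, fundamentalGroup_map_id_apply] at h

/-- A continuous self-map equal to the identity induces a surjection on `π₁(A, a)`. [folklore] -/
theorem fundamentalGroup_map_surjective_of_eq_id {f : C(A, A)} (hf : f = ContinuousMap.id A)
    (a : A) : Function.Surjective (FundamentalGroup.map f a) := by
  subst hf
  intro q
  exact ⟨q, fundamentalGroup_map_id_apply a q⟩

/-- **A homeomorphism induces an isomorphism of fundamental groups**: for `e : A ≃ₜ B`, the
homomorphism `e_* : π₁(A, a) → π₁(B, e a)` (Mathlib's `FundamentalGroup.map`) is bijective, with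
inverse induced by `e⁻¹` (Hatcher, *Algebraic Topology*, §1.1, p. 34).  Dot-notation extension
in Mathlib's `Homeomorph` namespace, declared inside the topic namespace. [folklore] -/
theorem Homeomorph.fundamentalGroup_map_bijective (e : A ≃ₜ B) (a : A) :
    Function.Bijective (FundamentalGroup.map (e : C(A, B)) a) := by
  constructor
  · intro p q h
    have h' := congrArg (FundamentalGroup.map (e.symm : C(B, A)) ((e : C(A, B)) a)) h
    rw [← fundamentalGroup_map_comp_apply, ← fundamentalGroup_map_comp_apply] at h'
    exact fundamentalGroup_map_injective_of_eq_id (f := (e.symm : C(B, A)).comp (e : C(A, B)))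
      (ContinuousMap.ext fun x => e.symm_apply_apply x) a h'
  · have hs : Function.Surjective
        (FundamentalGroup.map (e : C(A, B)) ((e.symm : C(B, A)) ((e : C(A, B)) a))) := by
      intro q
      obtain ⟨p, hp⟩ := fundamentalGroup_map_surjective_of_eq_id
        (f := (e : C(A, B)).comp (e.symm : C(B, A)))
        (ContinuousMap.ext fun y => e.apply_symm_apply y) ((e : C(A, B)) a) q
      rw [fundamentalGroup_map_comp_apply] at hp
      exact ⟨_, hp⟩
    have hea : (e.symm : C(B, A)) ((e : C(A, B)) a) = a := e.symm_apply_apply a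
    rwa [hea] at hs

end FundamentalGroupMap

/-! ### Naturality of Gay–Kirby trisections under diffeomorphisms -/

section Transport

variable {X : Type u} [TopologicalSpace X] [ChartedSpace (EuclideanSpace ℝ (Fin 4)) X]
  [IsManifold (𝓡 4) ∞ X]
  {X' : Type (max u v)} [TopologicalSpace X'] [ChartedSpace (EuclideanSpace ℝ (Fin 4)) X']
  [IsManifold (𝓡 4) ∞ X']

/-- Transport of a maximal-atlas chart along a diffeomorphism: for `c` in the maximal `C^m`
atlas of `M` and a `C^m` diffeomorphism `Ψ : M' ≅ M` (same model), `c ∘ Ψ` is in the maximal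
`C^m` atlas of `M'` (it and its inverse are `C^m`; Mathlib's
`IsManifold.mem_maximalAtlas_iff_contMDiffOn`).  Local copy of the tree's
`trans_mem_maximalAtlas_of_diffeomorph` (`OpenCollar.lean`), kept private to avoid the import.
[folklore] -/
private theorem transChart_mem_maximalAtlas {E' H' : Type*} [NormedAddCommGroup E']
    [NormedSpace ℝ E'] [TopologicalSpace H'] {I' : ModelWithCorners ℝ E' H'} {m : WithTop ℕ∞}
    {M : Type*} [TopologicalSpace M] [ChartedSpace H' M] {M' : Type*} [TopologicalSpace M']
    [ChartedSpace H' M'] [IsManifold I' m M] [IsManifold I' m M'] (Ψ : M' ≃ₘ^m⟮I', I'⟯ M)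
    {c : OpenPartialHomeomorph M H'} (hc : c ∈ IsManifold.maximalAtlas I' m M) :
    Ψ.toHomeomorph.toOpenPartialHomeomorph ≫ₕ c ∈ IsManifold.maximalAtlas I' m M' := by
  set c' : OpenPartialHomeomorph M' H' := Ψ.toHomeomorph.toOpenPartialHomeomorph ≫ₕ c with hc'
  rw [IsManifold.mem_maximalAtlas_iff_contMDiffOn]
  constructor
  · have h1 := contMDiffOn_of_mem_maximalAtlas hc
    have : ContMDiffOn I' I' m (c ∘ Ψ) c'.source := by
      refine h1.comp Ψ.contMDiff.contMDiffOn ?_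
      intro y hy
      simpa [hc'] using hy
    exact this.congr fun y _ => by simp [hc']
  · have h1 := contMDiffOn_symm_of_mem_maximalAtlas hc
    have : ContMDiffOn I' I' m (Ψ.symm ∘ c.symm) c'.target := by
      refine Ψ.symm.contMDiff.comp_contMDiffOn (h1.mono ?_)
      intro y hy
      simpa [hc'] using hy
    exact this.congr fun y _ => by simp [hc']

/-- **Gay–Kirby's Definition 1 is natural under diffeomorphisms.**  If `S` is a
`(g; k₀, k₁, k₂)`-trisection of the smooth 4-manifold `X` with corners along the central surface
(`IsGKTrisection`) and `Φ : X ≅ X'` is a diffeomorphism onto a smooth 4-manifold `X'` (possibly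
in a larger universe), then the sectors `Φ '' S i` form a `(g; k₀, k₁, k₂)`-trisection of `X'`:
the abstract pieces `W ≅ Z_{kᵢ}`, `H ≅ H_g` are kept (lifted by `ULift`, same handle
decompositions, `ManifoldULift.hasHandleDecomposition`) and re-parametrised by `Φ ∘ e ∘ down`,
`Φ ∘ h ∘ down`; topological embeddings, `C^∞` immersions off `F`, smooth embeddings and corner
charts `(φ, ψ, A)` are transported to `(φ ∘ down, ψ ∘ Φ⁻¹, A)` (composition with diffeomorphisms,
`IsImmersionAtOfComplement.comp_diffeomorph/diffeomorph_comp`, `IsSmoothEmbedding.…`); unions,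
pairwise and triple intersections and boundaries commute with the bijection `Φ`.  This is the
(tacit) invariance of Gay–Kirby's Def. 1 under diffeomorphism, used by Abrams–Gay–Kirby when
`𝒢` is read "up to trisected diffeomorphism" (p. 1540).
[cite: GayKirby2016, Def. 1] -/
theorem IsGKTrisection.image_diffeomorph {g : ℕ} {k : Fin 3 → ℕ} {S : Fin 3 → Set X}
    (h : IsGKTrisection X g k S) (Φ : X ≃ₘ⟮𝓡 4, 𝓡 4⟯ X') :
    IsGKTrisection X' g k (fun i => Φ '' S i) := by
  obtain ⟨hcov, hsec, hpair⟩ := h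
  have hbij : Function.Bijective Φ := EquivLike.bijective Φ
  have hinj : Function.Injective Φ := hbij.1
  have hI : (⋂ l, Φ '' S l) = Φ '' ⋂ l, S l := (image_iInter hbij S).symm
  refine ⟨?_, fun i => ?_, fun i j hij => ?_⟩
  · show (⋃ i, Φ '' S i) = univ
    rw [← image_iUnion, hcov, image_univ, (EquivLike.surjective Φ).range_eq]
  · obtain ⟨W, _, _, e, hM, hW, hc, hh, he, hrange, himm, hcorner, hbdry⟩ := hsec i
    haveI := hM; haveI := hW; haveI := hc
    let d : ULift.{v} W ≃ₘ⟮𝓡∂ 4, 𝓡∂ 4⟯ W := ManifoldULift.diffeomorph (𝓡∂ 4) W ∞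
    have hdcoe : (⇑d : ULift.{v} W → W) = ULift.down := rfl
    have hdsurj : Function.Surjective d := EquivLike.surjective d
    refine ⟨ULift.{v} W, inferInstance, inferInstance, Φ ∘ e ∘ ⇑d, inferInstance, inferInstance,
      inferInstance, ManifoldULift.hasHandleDecomposition hh,
      Φ.toHomeomorph.isEmbedding.comp (he.comp d.toHomeomorph.isEmbedding), ?_, ?_, ?_, ?_⟩
    · show range (Φ ∘ e ∘ ⇑d) = Φ '' S i
      rw [range_comp, range_comp, hdsurj.range_eq, image_univ, hrange]
    · intro w hw
      have hw' : e (d w) ∉ ⋂ l, S l := by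
        simpa only [hI, Function.comp_apply, hinj.mem_set_image] using hw
      obtain ⟨F, _, _, hF⟩ := himm (d w) hw'
      exact ⟨F, inferInstance, inferInstance, (hF.comp_diffeomorph d).diffeomorph_comp Φ⟩
    · intro w hw
      have hw' : e (d w) ∈ ⋂ l, S l := by
        simpa only [hI, Function.comp_apply, hinj.mem_set_image] using hw
      obtain ⟨φ, ψ, A, hφ, hψ, hws, hsrc, hw0, hloc⟩ := hcorner (d w) hw'
      have htarget : ((d.toHomeomorph.toOpenPartialHomeomorph ≫ₕ φ).extend (𝓡∂ 4)).target =
          (φ.extend (𝓡∂ 4)).target := by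
        simp [OpenPartialHomeomorph.extend]
      have hsymm : ∀ y, ((d.toHomeomorph.toOpenPartialHomeomorph ≫ₕ φ).extend (𝓡∂ 4)).symm y =
          d.symm ((φ.extend (𝓡∂ 4)).symm y) := by
        intro y
        simp [OpenPartialHomeomorph.extend]
      refine ⟨d.toHomeomorph.toOpenPartialHomeomorph ≫ₕ φ,
        Φ.symm.toHomeomorph.toOpenPartialHomeomorph ≫ₕ ψ, A, transChart_mem_maximalAtlas d hφ,
        transChart_mem_maximalAtlas Φ.symm hψ, ?_, ?_, ?_, ?_⟩
      · simpa using hws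
      · intro w₁ hw₁
        have hw₁' : d w₁ ∈ φ.source := by simpa using hw₁
        have h₁ := hsrc hw₁'
        simp only [mem_preimage] at h₁
        simpa using h₁
      · simpa using hw0
      · intro x hx
        rw [htarget] at hx
        have hrw : A.symm ((Φ.symm.toHomeomorph.toOpenPartialHomeomorph ≫ₕ ψ)
            ((Φ ∘ e ∘ ⇑d) (((d.toHomeomorph.toOpenPartialHomeomorph ≫ₕ φ).extend (𝓡∂ 4)).symm x)))
            = A.symm (ψ (e ((φ.extend (𝓡∂ 4)).symm x))) := by
          rw [hsymm]
          simp
        rw [hrw]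
        exact hloc x hx
    · intro j hj
      show Φ '' S i ∩ Φ '' S j ⊆ (Φ ∘ e ∘ ⇑d) '' (𝓡∂ 4).boundary (ULift.{v} W)
      rw [← image_inter hinj, image_comp Φ (e ∘ ⇑d), image_comp e ⇑d, ManifoldULift.boundary_eq,
        hdcoe, image_preimage_eq _ ULift.down_surjective]
      exact image_mono (hbdry j hj)
  · obtain ⟨H, _, _, f, hM, hH, hc, hh, hf, hrange, hbdry⟩ := hpair i j hij
    haveI := hM; haveI := hH; haveI := hc
    let d : ULift.{v} H ≃ₘ⟮𝓡∂ 3, 𝓡∂ 3⟯ H := ManifoldULift.diffeomorph (𝓡∂ 3) H ∞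
    have hdcoe : (⇑d : ULift.{v} H → H) = ULift.down := rfl
    have hdsurj : Function.Surjective d := EquivLike.surjective d
    refine ⟨ULift.{v} H, inferInstance, inferInstance, Φ ∘ f ∘ ⇑d, inferInstance, inferInstance,
      inferInstance, ManifoldULift.hasHandleDecomposition hh,
      (hf.comp_diffeomorph d).diffeomorph_comp Φ, ?_, ?_⟩
    · show range (Φ ∘ f ∘ ⇑d) = Φ '' S i ∩ Φ '' S j
      rw [range_comp, range_comp, hdsurj.range_eq, image_univ, hrange, image_inter hinj]
    · show (Φ ∘ f ∘ ⇑d) '' (𝓡∂ 3).boundary (ULift.{v} H) = ⋂ l, Φ '' S l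
      rw [image_comp Φ (f ∘ ⇑d), image_comp f ⇑d, ManifoldULift.boundary_eq, hdcoe,
        image_preimage_eq _ ULift.down_surjective, hbdry, hI]

/-- Same-universe form of `IsGKTrisection.image_diffeomorph`: a diffeomorphism `Φ : X ≅ X'`
between smooth 4-manifolds of one universe carries a Gay–Kirby trisection `S` of `X` to the
Gay–Kirby trisection `Φ '' S i` of `X'`. [cite: GayKirby2016, Def. 1] -/
theorem IsGKTrisection.image_diffeomorph' {X₁ X₂ : Type u} [TopologicalSpace X₁]
    [ChartedSpace (EuclideanSpace ℝ (Fin 4)) X₁] [IsManifold (𝓡 4) ∞ X₁] [TopologicalSpace X₂]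
    [ChartedSpace (EuclideanSpace ℝ (Fin 4)) X₂] [IsManifold (𝓡 4) ∞ X₂]
    {g : ℕ} {k : Fin 3 → ℕ} {S : Fin 3 → Set X₁} (h : IsGKTrisection X₁ g k S)
    (Φ : X₁ ≃ₘ⟮𝓡 4, 𝓡 4⟯ X₂) : IsGKTrisection X₂ g k (fun i => Φ '' S i) :=
  IsGKTrisection.image_diffeomorph.{u, u} h Φ

end Transport

/-! ### Naturality of the kernel triple `𝒢` -/

section Kernels

variable {X : Type u} [TopologicalSpace X] [ChartedSpace (EuclideanSpace ℝ (Fin 4)) X]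
  {X' : Type v} [TopologicalSpace X'] [ChartedSpace (EuclideanSpace ℝ (Fin 4)) X']

/-- **The Abrams–Gay–Kirby kernel triple is natural under homeomorphisms of trisected
4-manifolds.**  Let `S` be a Gay–Kirby trisection of `X`, `Φ : X ≃ₜ X'` a homeomorphism and
suppose the images `Φ '' S i` form a Gay–Kirby trisection of `X'` (e.g. `Φ` a diffeomorphism,
`IsGKTrisection.image_diffeomorph`).  Then for every base point `x₀ ∈ F` and marking
`μ : S_g ≃* π₁(F, x₀)` there are a base point `x₀' = Φ x₀ ∈ F' = Φ(F)` and a marking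
`μ' = (Φ|_F)_* ∘ μ` of the central surface of `X'` with *the same* kernel triple:
`ker(π₁ F' → π₁ H'ᵢ) ∘ (Φ|_F)_* = ker(π₁ F → π₁ Hᵢ)` because the squares
`F ⊆ Hᵢ`, `F' ⊆ H'ᵢ` commute with the restrictions of `Φ` and `(Φ|_{Hᵢ})_*` is injective
(`Homeomorph.fundamentalGroup_map_bijective`).  Abrams–Gay–Kirby, p. 1540: `𝒢` is defined on
trisected 4-manifolds up to trisected diffeomorphism. [cite: AbramsGayKirby2018, p. 1540 (the map 𝒢)] -/
theorem exists_groupGKTrisectionOf_eq_of_homeomorph {g : ℕ} {k k' : Fin 3 → ℕ}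
    {S : Fin 3 → Set X} (h : IsGKTrisection X g k S) (Φ : X ≃ₜ X')
    (h' : IsGKTrisection X' g k' (fun i => Φ '' S i)) (x₀ : centralSurface S)
    (μ : SurfaceGroup g ≃* FundamentalGroup (centralSurface S) x₀) :
    ∃ (x₀' : centralSurface (fun i => Φ '' S i))
      (μ' : SurfaceGroup g ≃* FundamentalGroup (centralSurface (fun i => Φ '' S i)) x₀'),
      (x₀' : X') = Φ x₀ ∧ groupGKTrisectionOf h' x₀' μ' = groupGKTrisectionOf h x₀ μ := by
  have hinj : Function.Injective Φ := Φ.injective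
  have hF : ∀ x : X, x ∈ (⋂ l, S l) ↔ Φ x ∈ ⋂ l, (fun i => Φ '' S i) l := fun x => by
    simp only [mem_iInter, hinj.mem_set_image]
  have hH : ∀ (i : Fin 3) (x : X), x ∈ S (i + 1) ∩ S (i + 2) ↔
      Φ x ∈ (fun i => Φ '' S i) (i + 1) ∩ (fun i => Φ '' S i) (i + 2) := fun i x => by
    simp only [mem_inter_iff, hinj.mem_set_image]
  let ΦF : centralSurface S ≃ₜ centralSurface (fun i => Φ '' S i) := Φ.subtype hF
  let ΦH : ∀ i : Fin 3, handlebodyOpp S i ≃ₜ handlebodyOpp (fun i => Φ '' S i) i :=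
    fun i => Φ.subtype (hH i)
  let ΦFc : C(centralSurface S, centralSurface (fun i => Φ '' S i)) := ΦF
  let ΦHc : ∀ i : Fin 3, C(handlebodyOpp S i, handlebodyOpp (fun i => Φ '' S i) i) :=
    fun i => ΦH i
  refine ⟨ΦF x₀, μ.trans (MulEquiv.ofBijective (FundamentalGroup.map ΦFc x₀)
    (Homeomorph.fundamentalGroup_map_bijective ΦF x₀)), rfl, ?_⟩
  funext i
  ext γ
  rw [mem_groupGKTrisectionOf_iff, mem_groupGKTrisectionOf_iff, MulEquiv.trans_apply,
    MulEquiv.ofBijective_apply]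
  have key : FundamentalGroup.map (centralInclusion (fun i => Φ '' S i) i) (ΦF x₀)
      (FundamentalGroup.map ΦFc x₀ (μ γ)) =
      FundamentalGroup.map (ΦHc i) (centralInclusion S i x₀)
        (FundamentalGroup.map (centralInclusion S i) x₀ (μ γ)) :=
    (fundamentalGroup_map_comp_apply ΦFc (centralInclusion (fun i => Φ '' S i) i)
      x₀ (μ γ)).symm.trans
      (fundamentalGroup_map_comp_apply (centralInclusion S i) (ΦHc i) x₀ (μ γ))
  rw [key]
  constructor
  · intro h1
    apply (Homeomorph.fundamentalGroup_map_bijective (ΦH i) (centralInclusion S i x₀)).1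
    rw [h1, map_one]
    rfl
  · intro h1
    rw [h1, map_one]
    rfl

end Kernels

/-! ### Universe bookkeeping for fact (e′) -/

/-- **A kernel triple realised by a trisected 4-manifold in `Type` is realised in every
universe.**  If `K` is (isomorphic to) the kernel triple of a balanced Gay–Kirby
`(g, k)`-trisection of a closed, connected, oriented smooth 4-manifold `X : Type`, with some
base point and marking, then the same holds for some `X : Type u`: take `ULift X` with the
lifted smooth structure (`ManifoldULift`, canonically diffeomorphic to `X`), the lifted
orientation (`ManifoldULift.orientation`), the image trisection
(`IsGKTrisection.image_diffeomorph`) and the transported base point and marking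
(`exists_groupGKTrisectionOf_eq_of_homeomorph`, same kernel triple). [folklore] -/
theorem gkTrisected_ulift {g k : ℕ} {K : TrisectionKernels g}
    (h0 : ∃ (X : Type) (_ : TopologicalSpace X) (_ : T2Space X) (_ : SecondCountableTopology X)
      (_ : ChartedSpace (EuclideanSpace ℝ (Fin 4)) X) (_ : IsManifold (𝓡 4) ∞ X)
      (_ : CompactSpace X) (_ : ConnectedSpace X) (_ : SmoothOrientation (𝓡 4) X)
      (S : Fin 3 → Set X) (h : IsBalancedGKTrisection X g k S) (x₀ : centralSurface S)
      (μ : SurfaceGroup g ≃* FundamentalGroup (centralSurface S) x₀),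
      TrisectionKernels.Iso (groupGKTrisectionOf h x₀ μ) K) :
    ∃ (X : Type u) (_ : TopologicalSpace X) (_ : T2Space X) (_ : SecondCountableTopology X)
      (_ : ChartedSpace (EuclideanSpace ℝ (Fin 4)) X) (_ : IsManifold (𝓡 4) ∞ X)
      (_ : CompactSpace X) (_ : ConnectedSpace X) (_ : SmoothOrientation (𝓡 4) X)
      (S : Fin 3 → Set X) (h : IsBalancedGKTrisection X g k S) (x₀ : centralSurface S)
      (μ : SurfaceGroup g ≃* FundamentalGroup (centralSurface S) x₀),
      TrisectionKernels.Iso (groupGKTrisectionOf h x₀ μ) K := by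
  obtain ⟨X, _, _, _, _, _, _, _, o, S, hS, x₀, μ, hiso⟩ := h0
  let Φ : X ≃ₘ⟮𝓡 4, 𝓡 4⟯ ULift.{u} X :=
    (ManifoldULift.diffeomorph (𝓡 4) X ∞ : ULift.{u} X ≃ₘ⟮𝓡 4, 𝓡 4⟯ X).symm
  have h' : IsGKTrisection (ULift.{u} X) g (fun _ => k) (fun i => Φ.toHomeomorph '' S i) :=
    hS.isGKTrisection.image_diffeomorph Φ
  obtain ⟨x₀', μ', -, hK⟩ :=
    exists_groupGKTrisectionOf_eq_of_homeomorph hS.isGKTrisection Φ.toHomeomorph h' x₀ μ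
  refine ⟨ULift.{u} X, inferInstance, inferInstance, inferInstance, inferInstance, inferInstance,
    inferInstance, inferInstance, ManifoldULift.orientation o, fun i => Φ.toHomeomorph '' S i,
    h', x₀', μ', ?_⟩
  rw [hK]
  exact hiso

/-- **(e′) at universe `0` gives (e′) at every universe.**  Given a `(g, k)` group trisection
`K` of `G : Type u`, the kernels `K` are also a `(g, k)` group trisection of the triple
quotient `S_g/⟪K₁ ∪ K₂ ∪ K₃⟫ : Type` (which is isomorphic to `G`); the universe-`0` fact
realises it by a trisected closed connected oriented smooth `X : Type`, and `gkTrisected_ulift`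
moves `X` to `Type u` without changing the kernel triple.  This is the exact shape of a future
discharge `exists_gkTrisected_of_isGroupTrisection_holds` (implicitly universe-polymorphic)
from a construction carried out in `Type`; the fact itself (Abrams–Gay–Kirby, Thm. 5: handlebody
fillings, Kneser–Stallings–Perelman, Laudenbach–Poénaru) is NOT proved here.
[cite: AbramsGayKirby2018, Thm. 5 (p. 1541)] -/
theorem exists_gkTrisected_of_isGroupTrisection_of_univ_zero
    (he : exists_gkTrisected_of_isGroupTrisection.{0}) :
    exists_gkTrisected_of_isGroupTrisection.{u} := by
  intro g k G _ K hK
  have hK₀ : IsGroupTrisection g k K.tripleQuotient K :=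
    ⟨hK.normal, hK.free_quotient, hK.free_pairQuotient, ⟨MulEquiv.refl _⟩⟩
  exact gkTrisected_ulift (he g k K.tripleQuotient K hK₀)

/-- **Abrams–Gay–Kirby, Thm. 5, genus-`0` clause of the map `ℳ`, at every universe: "The
unique `(0, 0)`-trisection of `{1}` maps to the unique `(0, 0)`-trisection of `S⁴`."**  Every
`(0, k)` group trisection `K` of a group `G` (necessarily `k = 0`, `K = (⊤, ⊤, ⊤)`, `G = {1}`)
is isomorphic to the kernel triple of a balanced `(0, k)`-trisection, with corners along the
central surface, of a closed, connected, oriented smooth 4-manifold `X : Type u` — the lift to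
`Type u` (`gkTrisected_ulift`) of the round `S⁴ ⊆ ℝ⁵` trisected by Gay–Kirby's sectors
(`exists_gkTrisected_of_isGroupTrisection_genusZero`, universe `0`).  This is the `g = 0`
instance of the named fact (e′) `exists_gkTrisected_of_isGroupTrisection.{u}` for every `u`; the
cases `g ≥ 1` are Theorem 5 proper and remain a named fact.
[cite: AbramsGayKirby2018, Thm. 5 (p. 1541)] -/
theorem exists_gkTrisected_of_isGroupTrisection_genusZero_univ (k : ℕ) (G : Type*) [Group G]
    (K : TrisectionKernels 0) (hK : IsGroupTrisection 0 k G K) :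
    ∃ (X : Type u) (_ : TopologicalSpace X) (_ : T2Space X) (_ : SecondCountableTopology X)
      (_ : ChartedSpace (EuclideanSpace ℝ (Fin 4)) X) (_ : IsManifold (𝓡 4) ∞ X)
      (_ : CompactSpace X) (_ : ConnectedSpace X) (_ : SmoothOrientation (𝓡 4) X)
      (S : Fin 3 → Set X) (h : IsBalancedGKTrisection X 0 k S) (x₀ : centralSurface S)
      (μ : SurfaceGroup 0 ≃* FundamentalGroup (centralSurface S) x₀),
      TrisectionKernels.Iso (groupGKTrisectionOf h x₀ μ) K :=
  gkTrisected_ulift (exists_gkTrisected_of_isGroupTrisection_genusZero k G K hK)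

end Literature.Topology.FourManifolds

end
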